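import Summits.AtomisticToContinuum.BoseEinsteinCondensation.Theorems.BECCutLineWeakDisorderWitnessTransferRatio
import Literature.MathematicalPhysics.QuantumManyBody.BoseGasHardSet
import Literature.MathematicalPhysics.QuantumManyBody.BoseGasThermodynamicLimitRuelle
import HarnessLib

/-!
# Route BECCutLineWeakDisorder — `WitnessTransfer`, line `Sketch`: the hard-set margin, finite
energy at low density, bookkeeping

Support file (does not close the item) for the crux stmt-AtomisticToContinuum-14978
(`Summit.AtomisticToContinuum.BoseEinsteinCondensation.Theses.BECCutLineWeakDisorder.WitnessTransfer`),
feeding the glue `stub_landscape_of_parts` of the registered skeleton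
(`Cruxes/WitnessTransfer/Lines/Sketch.lean`):

* `glue_setLIntegral_interaction_ne_top` — on a measurable region of the box whose relative
  positions keep a margin from the hard set `hardVec v` the interaction is integrable;
* `glue_eventually_groundStateEnergy_ne_top` — at low density the Dirichlet energy of `n + 1`
  bosons in the thermodynamic box is eventually finite;
* `glue_arith_energy`, `glue_arith_ratio` — the real-arithmetic bookkeeping of the glue.
-/

noncomputable section

open MeasureTheory Filter Set Metric
open scoped ENNReal NNReal Topology

namespace Summit.AtomisticToContinuum.BoseEinsteinCondensation.Theorems.CutLineWitness

open Literature.MathematicalPhysics.QuantumManyBody.BoseGas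
/-! ### The hard-set margin -/

/-- **The interaction is integrable on a box region keeping a margin from the hard set.** If
`S ⊆ Λ_L^N` is measurable and every relative position `xᵢ − xⱼ` (`i ≠ j`) of every `X ∈ S`
keeps distance `≥ κ > 0` from the hard set `hardVec v`, then `∫_S ∑_{i<j} v(|xᵢ − xⱼ|) < ∞`:
the relative positions range in a compact set avoiding the hard set, where `v(|·|)` is integrable
(`setLIntegral_lt_top_of_isCompact_subset_compl_hardVec`), and the `xᵢ`-marginal of each pair
term is bounded by that integral (comparison of one-coordinate marginals, `lmarginal`).
[folklore] -/
theorem glue_setLIntegral_interaction_ne_top {N : ℕ} {v : ℝ → ℝ≥0∞} (hv : IsRepulsiveFiniteRange v)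
    {L κ : ℝ} (hκ : 0 < κ) {S : Set (Config N)} (hSm : MeasurableSet S) (hSbox : S ⊆ boxN N L)
    (hS : ∀ X ∈ S, ∀ i j : Fin N, i ≠ j → ∀ z ∈ hardVec v, κ ≤ dist (X i - X j) z) :
    ∫⁻ X in S, interaction v X ≠ ⊤ := by
  classical
  -- no particles: no interaction
  rcases isEmpty_or_nonempty (Fin N) with hN | ⟨⟨i₀⟩⟩
  · have h0 : ∀ X : Config N, interaction v X = 0 := fun X => by
      unfold interaction; simp
    simp [h0]
  -- the degenerate box
  rcases le_or_gt L 0 with hL | hL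
  · have hempty : S = ∅ := by
      refine Set.eq_empty_of_forall_notMem fun X hX => ?_
      have h := (hSbox hX i₀ 0).1
      have h' := (hSbox hX i₀ 0).2
      linarith
    rw [hempty, Measure.restrict_empty, lintegral_zero_measure]
    exact ENNReal.zero_ne_top
  -- norms of relative positions in the box
  have hnorm : ∀ X ∈ boxN N L, ∀ i j : Fin N, ‖X i - X j‖ ≤ 2 * L := by
    intro X hX i j
    have hcoord : ∀ (x : Space), x ∈ box L → ‖x‖ ≤ L * Real.sqrt 3 := by
      intro x hx
      rw [EuclideanSpace.norm_eq]
      calc Real.sqrt (∑ k, ‖x k‖ ^ 2) ≤ Real.sqrt (∑ _k : Fin 3, L ^ 2) := by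
            refine Real.sqrt_le_sqrt (Finset.sum_le_sum fun k _ => ?_)
            have h1 := (hx k).1
            have h2 := (hx k).2
            rw [Real.norm_eq_abs, sq_abs]
            nlinarith
        _ = L * Real.sqrt 3 := by
            rw [Finset.sum_const, Finset.card_univ, Fintype.card_fin, nsmul_eq_mul,
              Nat.cast_ofNat, mul_comm, Real.sqrt_mul (sq_nonneg _), Real.sqrt_sq hL.le]
    have h3 : Real.sqrt 3 ≤ 2 := by
      rw [Real.sqrt_le_left (by norm_num)]; norm_num
    have hi := hcoord _ (hX i)
    have hj := hcoord _ (hX j)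
    -- both points lie in the box: their difference has norm `< L√3 ≤ 2L`; crude via `dist ≤`
    have hd : ‖X i - X j‖ ≤ L * Real.sqrt 3 := by
      rw [← dist_eq_norm, EuclideanSpace.dist_eq]
      calc Real.sqrt (∑ k, dist (X i k) (X j k) ^ 2) ≤ Real.sqrt (∑ _k : Fin 3, L ^ 2) := by
            refine Real.sqrt_le_sqrt (Finset.sum_le_sum fun k _ => ?_)
            have h1 := (hX i k).1
            have h2 := (hX i k).2
            have h3 := (hX j k).1
            have h4 := (hX j k).2
            rw [Real.dist_eq, sq_abs]
            nlinarith
        _ = L * Real.sqrt 3 := by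
            rw [Finset.sum_const, Finset.card_univ, Fintype.card_fin, nsmul_eq_mul,
              Nat.cast_ofNat, mul_comm, Real.sqrt_mul (sq_nonneg _), Real.sqrt_sq hL.le]
    nlinarith
  -- the compact set of admissible relative positions and its finite integral
  set K : Set Space := Metric.closedBall (0 : Space) (2 * L) ∩ {w | ∀ z ∈ hardVec v, κ ≤ dist w z}
    with hKdef
  have hKclosed : IsClosed {w : Space | ∀ z ∈ hardVec v, κ ≤ dist w z} := by
    simp only [Set.setOf_forall]
    exact isClosed_iInter fun z => isClosed_iInter fun _ =>
      isClosed_le continuous_const (continuous_id.dist continuous_const)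
  have hKc : IsCompact K := (isCompact_closedBall _ _).inter_right hKclosed
  have hKm : MeasurableSet K := hKc.isClosed.measurableSet
  have hKH : K ⊆ (hardVec v)ᶜ := fun w hw hwH => by
    have := hw.2 w hwH
    rw [dist_self] at this
    linarith
  set G : ℝ≥0∞ := ∫⁻ w in K, v ‖w‖ with hGdef
  have hGtop : G < ⊤ := setLIntegral_lt_top_of_isCompact_subset_compl_hardVec hKc hKH
  set g : Space → ℝ≥0∞ := K.indicator fun w => v ‖w‖ with hgdef
  have hgm : Measurable g := (hv.1.comp measurable_norm).indicator hKm
  have hg_int : ∀ p : Space, ∫⁻ x, g (x - p) = G := fun p => by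
    rw [lintegral_sub_right_eq_self g p, hgdef, lintegral_indicator hKm]
  -- volumes
  have hvol0 : volume (box L) ≠ 0 := (volume_box_pos hL).ne'
  have hvoltop : volume (box L) ≠ ⊤ := volume_box_ne_top L
  -- the pair bound
  have hpair : ∀ i j : Fin N, i ≠ j → ∫⁻ X in S, v (dist (X i) (X j)) ≤ G / volume (box L) *
      volume (boxN N L) := by
    intro i j hij
    set F : Config N → ℝ≥0∞ := (boxN N L).indicator fun X => g (X i - X j) with hFdef
    set H : Config N → ℝ≥0∞ := (boxN N L).indicator fun _ => G / volume (box L) with hHdef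
    have hFm : Measurable F :=
      (hgm.comp ((measurable_pi_apply i).sub (measurable_pi_apply j))).indicator
        (measurableSet_boxN N L)
    have hHm : Measurable H := measurable_const.indicator (measurableSet_boxN N L)
    -- `1_S v ≤ F`
    have h1 : ∫⁻ X in S, v (dist (X i) (X j)) ≤ ∫⁻ X, F X := by
      rw [← lintegral_indicator hSm]
      refine lintegral_mono fun X => ?_
      by_cases hX : X ∈ S
      · have hXb := hSbox hX
        rw [Set.indicator_of_mem hX, hFdef, Set.indicator_of_mem hXb, hgdef,
          Set.indicator_of_mem, dist_eq_norm]
        exact ⟨Metric.mem_closedBall.2 (by rw [dist_zero_right]; exact hnorm X hXb i j),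
          hS X hX i j hij⟩
      · rw [Set.indicator_of_notMem hX]; exact zero_le
    -- `∫ F ≤ ∫ H` by comparing the `xᵢ`-marginals
    have h2 : ∫⁻ X, F X ≤ ∫⁻ X, H X := by
      have hvol : (volume : Measure (Config N)) = Measure.pi fun _ => volume := rfl
      rw [hvol]
      refine lintegral_le_of_lmarginal_le {i} hFm hHm fun Y => ?_
      rw [lmarginal_singleton, lmarginal_singleton]
      change (∫⁻ x : Space, F (Function.update Y i x)) ≤ ∫⁻ x : Space, H (Function.update Y i x)
      have hmem : ∀ x : Space, Function.update Y i x ∈ boxN N L ↔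
          x ∈ box L ∧ ∀ k, k ≠ i → Y k ∈ box L := fun x => by
        show (∀ k, Function.update Y i x k ∈ box L) ↔ _
        exact Function.forall_update_iff Y (p := fun _ y => y ∈ box L)
      by_cases hB : ∀ k, k ≠ i → Y k ∈ box L
      · have hF' : ∀ x, F (Function.update Y i x) ≤ g (x - Y j) := fun x => by
          rw [hFdef]
          refine (Set.indicator_le_self _ _ (Function.update Y i x)).trans (le_of_eq ?_)
          simp [Function.update_self, Function.update_of_ne hij.symm]
        have hH' : ∀ x, H (Function.update Y i x) = (box L).indicator (fun _ => G / volume (box L)) x :=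
          fun x => by
          rw [hHdef]
          by_cases hx : x ∈ box L
          · rw [Set.indicator_of_mem ((hmem x).2 ⟨hx, hB⟩), Set.indicator_of_mem hx]
          · rw [Set.indicator_of_notMem (fun h => hx ((hmem x).1 h).1), Set.indicator_of_notMem hx]
        calc (∫⁻ x : Space, F (Function.update Y i x)) ≤ ∫⁻ x, g (x - Y j) := lintegral_mono hF'
          _ = G := hg_int (Y j)
          _ = G / volume (box L) * volume (box L) := (ENNReal.div_mul_cancel hvol0 hvoltop).symm
          _ = ∫⁻ x : Space, H (Function.update Y i x) := by
              simp_rw [hH']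
              rw [lintegral_indicator (measurableSet_box L), setLIntegral_const]
      · have hF0 : ∀ x, F (Function.update Y i x) = 0 := fun x => by
          rw [hFdef, Set.indicator_of_notMem (fun h => hB ((hmem x).1 h).2)]
        simp [hF0]
    have h3 : ∫⁻ X, H X = G / volume (box L) * volume (boxN N L) := by
      rw [hHdef, lintegral_indicator (measurableSet_boxN N L), setLIntegral_const]
    exact h1.trans (h2.trans h3.le)
  -- summing over the pairs
  have hmeas : ∀ i j : Fin N, Measurable fun X : Config N => v (dist (X i) (X j)) :=
    fun i j => hv.1.comp (measurable_dist_pair i j)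
  have hsum : ∫⁻ X in S, interaction v X =
      ∑ i : Fin N, ∑ j ∈ Finset.univ.filter (fun j => i < j), ∫⁻ X in S, v (dist (X i) (X j)) := by
    unfold interaction
    rw [lintegral_finsetSum _ fun i _ => Finset.measurable_sum _ fun j _ => hmeas i j]
    refine Finset.sum_congr rfl fun i _ => ?_
    rw [lintegral_finsetSum _ fun j _ => hmeas i j]
  rw [hsum]
  refine (ENNReal.sum_lt_top.2 fun i _ => ENNReal.sum_lt_top.2 fun j hj => ?_).ne
  have hij : i ≠ j := (Finset.mem_filter.1 hj).2.ne
  refine (hpair i j hij).trans_lt (ENNReal.mul_lt_top ?_ (volume_boxN_lt_top N L))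
  exact ENNReal.div_lt_top hGtop.ne hvol0

/-- **At low density the variational energy is eventually finite**: for an admissible `v` there
is `ρ₀ > 0` such that for `0 < ρ < ρ₀`, `groundStateEnergy v (n+1) (sideLength ρ (n+1)) < ∞`
for all large `n` (Ruelle's subcritical bound `limsup_lt_top_of_small`).
[cite: LSSY2005, Ch. 2 eq. (2.2)] -/
theorem glue_eventually_groundStateEnergy_ne_top (v : ℝ → ℝ≥0∞) (hv : IsRepulsiveFiniteRange v) :
    ∃ ρ₀ : ℝ, 0 < ρ₀ ∧ ∀ ρ : ℝ, 0 < ρ → ρ < ρ₀ → ∀ᶠ n : ℕ in atTop,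
      groundStateEnergy v (n + 1) (sideLength ρ (n + 1)) ≠ ⊤ := by
  obtain ⟨R, hR, hv0⟩ := hv.exists_pos_range
  have hR3 : 0 < (1 + R) ^ 3 := by positivity
  refine ⟨1 / (2 * (1 + R) ^ 3), by positivity, fun ρ hρ hρlt => ?_⟩
  have hsmall : ρ * (1 + R) ^ 3 < 1 := by
    rw [lt_div_iff₀ (by positivity)] at hρlt
    nlinarith
  have hlim := limsup_lt_top_of_small hv.1 hv0 hR hρ hsmall
  rw [limsupEnergyPerParticle] at hlim
  have hev : ∀ᶠ N : ℕ in atTop, energyPerParticleDirichlet v ρ N < ⊤ :=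
    Filter.eventually_lt_of_limsup_lt hlim
  have hev' := (tendsto_add_atTop_nat 1).eventually hev
  filter_upwards [hev'] with n hn
  rw [energyPerParticleDirichlet, lt_top_iff_ne_top, Ne, ENNReal.div_eq_top, not_or] at hn
  intro htop
  exact hn.2 ⟨htop, ENNReal.natCast_ne_top (n + 1)⟩


/-! ### Arithmetic -/

/-- Energy bookkeeping of the glue: with `θ = (δ/2)/(E₀ + δ/2)`, `τ ≤ θ/4`, `c² q ≤ 1 + ε_b`,
`q ≥ 1 − τ`, `E ≤ E₀ + δ/4`, `ε_b ≤ δ/8`: `c² (E + ε_b) ≤ E₀ + δ`. [folklore] -/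
theorem glue_arith_energy {E₀r δr E εb τ θ c2 q : ℝ} (hE₀ : 0 ≤ E₀r) (hδ : 0 < δr)
    (hθ : θ = (δr / 2) / (E₀r + δr / 2)) (hτ0 : 0 < τ) (hτ : τ ≤ θ / 4) (hτ4 : τ ≤ 1 / 4)
    (hE : E ≤ E₀r + δr / 4) (hE0 : 0 ≤ E) (hεb0 : 0 ≤ εb) (hεb : εb ≤ δr / 8) (hεbτ : εb ≤ τ)
    (hq : 1 - τ ≤ q) (hc2 : 0 ≤ c2) (hcq : c2 * q ≤ 1 + εb) :
    c2 * (E + εb) ≤ E₀r + δr := by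
  have hθpos : 0 < θ := by rw [hθ]; positivity
  have hθle : θ ≤ 1 := by
    rw [hθ, div_le_one (by positivity)]; linarith
  have hq0 : 0 < q := by linarith
  -- `c2 ≤ (1 + τ)/(1 - τ) ≤ 1 + θ`
  have hc2' : c2 ≤ 1 + θ := by
    have h1 : c2 * (1 - τ) ≤ 1 + τ := by nlinarith
    nlinarith
  have hkey : (1 + θ) * (E₀r + δr / 2) = E₀r + δr := by
    rw [hθ]; field_simp; ring
  calc c2 * (E + εb) ≤ (1 + θ) * (E₀r + δr / 2) := by
        apply mul_le_mul hc2' (by linarith) (by linarith) (by linarith)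
    _ = E₀r + δr := hkey

/-- Ratio bookkeeping of the glue: with `τ ≤ 1/(8(C+1))`, `c² q ≤ 1 + ε_b`, `ε_b ≤ τ`,
`q ≥ 1 − τ`: `c² (C + 1/(8(C+1))) ≤ C + 1`. [folklore] -/
theorem glue_arith_ratio {C τ εb c2 q : ℝ} (hC : 0 ≤ C) (hτ0 : 0 < τ) (hτ : τ ≤ 1 / (8 * (C + 1)))
    (hεbτ : εb ≤ τ) (hq : 1 - τ ≤ q) (hc2 : 0 ≤ c2) (hcq : c2 * q ≤ 1 + εb) :
    c2 * (C + 1 / (8 * (C + 1))) ≤ C + 1 := by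
  have hC1 : 0 < C + 1 := by linarith
  have hτ8 : τ ≤ 1 / 8 := hτ.trans (by rw [div_le_div_iff₀ (by positivity) (by norm_num)]; nlinarith)
  have hq0 : 0 < q := by linarith
  -- `c2 ≤ 1 + 3τ`
  have hc2' : c2 ≤ 1 + 3 * τ := by
    have h1 : c2 * (1 - τ) ≤ 1 + τ := by nlinarith
    nlinarith
  have h3τ : 3 * τ ≤ 3 / (8 * (C + 1)) := by
    calc 3 * τ ≤ 3 * (1 / (8 * (C + 1))) := by linarith
      _ = 3 / (8 * (C + 1)) := by ring
  calc c2 * (C + 1 / (8 * (C + 1))) ≤ (1 + 3 / (8 * (C + 1))) * (C + 1 / (8 * (C + 1))) := by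
        apply mul_le_mul (hc2'.trans (by linarith)) le_rfl (by positivity) (by positivity)
    _ ≤ C + 1 := by
        rw [← sub_nonneg]
        have h : C + 1 - (1 + 3 / (8 * (C + 1))) * (C + 1 / (8 * (C + 1))) =
            (64 * (C + 1) ^ 3 - 64 * C * (C + 1) ^ 2 - 24 * C * (C + 1) - 8 * (C + 1) - 3) /
              (64 * (C + 1) ^ 2) := by
          field_simp; ring
        rw [h]
        apply div_nonneg _ (by positivity)
        nlinarith [sq_nonneg C, mul_nonneg hC hC]


end Summit.AtomisticToContinuum.BoseEinsteinCondensation.Theorems.CutLineWitness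

end
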